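import Mathlib
import Summits.Ventures.FusionMHD.Bench.SAlphaS25W15A15Panels1
import Summits.Ventures.FusionMHD.Bench.SAlphaS25W15A15625Panels1
import Literature.MathematicalPhysics.MHD.BallooningSAlphaWitnessInterval
import Summits.Ventures.FusionMHD.Models.SAlphaStableS25A14375M7Point
import HarnessLib

/-!
# F3 — THIRD-ROUND HALF-GAP END MOVE AT SHEAR `s = 5/2` (UPPER END ALONE): `3/2 ∈ U_{5/2}` — with gridfusion-model-7 (g9)'s
# `SAlphaStableS25A14375M7.stableSide_fiveHalves_2316 : SAlpha.StableSide (5/2) (23/16)` (the LOWER end of the bracket of record, BY NAME, p630369) the first-stability edge of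
# the `s–α` MODEL at `s = 5/2` lies in `[23/16, 3/2]` (width `1/16` = HALF of the s = 5/2 second-round joint row (`SAlphaStableS25A14375M7Point` + `SAlphaPolyWitnessS25A15625`, after ★ #246's `[11/8, 13/8]`)'s `[23/16, 25/16]`); and `U_{5/2} ⊇ [3/2, 25/16]` by ONE trial function
(venture LADDER-GRIDFUSION, rung F3; cell `gridfusion`; gridfusion-model-7 (g10), 2026-08-28, in gridfusion-lit-3's finite-element lane.
DIRECTOR RULING 67 (3) / lead RULINGS 9gl, 9gu (3): a COUNTED half-gap END MOVE is a tree theorem putting the edge inside a sub-interval of at most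
half the width of the bracket of record; at `s = 5/2` the bracket of record is the s = 5/2 second-round joint row (`SAlphaStableS25A14375M7Point` + `SAlphaPolyWitnessS25A15625`, after ★ #246's `[11/8, 13/8]`)'s `[23/16, 25/16]` (width `1/8`); the float edge
`1.49` lies in its LOWER half, so the UPPER end alone halves it: `[23/16, 3/2]` (width `1/16`).)

WHAT IS PROVED (kernel, std axioms; the 2 × 32 interval integrals are `decide +kernel` facts of the 4 Panels files):
* `unstableWitness_15 : UnstableWitness (5/2) (3/2) (−32) 32 X X′` and `unstableWitness_15625 : UnstableWitness (5/2) (25/16) (−32) 32 X X′` for the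
  SAME explicit `C²` piecewise-quintic `X = trialX 1 1 pieces (−32)` (`2⁶⁰·W ≤` the printed negative integers);
* `unstableWitness_band : ∀ α ∈ Icc (3/2) (25/16), UnstableWitness (5/2) α (−32) 32 X X′` (lit-3's `unstableWitness_of_mem_Icc`), `not_stableSide_of_mem_band`;
* ★★★ `endMove_fiveHalves : StableSide (5/2) (23/16) ∧ ¬ StableSide (5/2) (3/2)` — the END MOVE in one statement (lower end = `SAlphaStableS25A14375M7.stableSide_fiveHalves_2316` BY NAME).

## THREE COLUMNS
CERTIFIED: in the `s–α` ballooning MODEL at shear `s = 5/2`, with `U_{5/2}` = the set of `α` at which some compact window carries an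
instability witness (lit-3's `SAlpha.UnstableWitness`): `23/16 ∉ U` (gridfusion-model-7 (g9), Picone/Riccati core + tail) and `[3/2, 25/16] ⊆ U` (this file) ⇒
`inf {α ≥ 23/16 : α ∈ U} ∈ [23/16, 3/2]` CLOSED, width `1/16`; with `model-7's `SAlphaPolyWitnessS25A15625.unstableWitness_fiveHalves_2516` (`25/16`, p624841), `S25A1625` / `S25A175` and ★ #250's lens` the certified unstable set at `s = 5/2` stays ONE
connected interval from `3/2` up to `lensHi (5/2)`.  Monotonicity / continuity of the edge in `α` NOT typed.  VALIDATED (not in the kernel): E–L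
shooting edge `α ≈ 1.49` (lit-4 kit j299948); float energies above; the printed fit `α ≈ 0.6 s` (12.100) gives `1.5`.  MODELLED: `s–α` model
(large-aspect-ratio shifted circles, high-`n` ballooning ordering, `θ₀ = 0`, ideal MHD); «unstable» = the MODEL's one-surface energy admits a negative
compactly supported `C¹` trial function (representation step `W̄ < 0 ⇒ δW < 0`, Connor–Hastie–Taylor 1979, quoted in the Literature file, NOT typed);
no device, no `β`-limit, no second-stability claim here.  Citations: Freidberg 2014 §8.7 (p0318), §12.3 (12.38)–(12.40), §12.6.2 (12.96)–(12.100)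
[Freidberg2014]; Mahboubi–Melquiond–Sibut-Pinote 2016 §3.2–3.3 [MahboubiMelquiondSibutpinote2016].
-/

open Literature.Analysis.ValidatedNumerics Literature.Analysis.ValidatedNumerics.PolyMP
open Literature.Analysis.ValidatedNumerics.NumericsMP Literature.Analysis.ValidatedNumerics.ExpPoly
open Literature.MathematicalPhysics.MHD.Ballooning Literature.MathematicalPhysics.MHD.Ballooning.SAlpha
open Literature.MathematicalPhysics.MHD.Ballooning.SAlpha.Spline
open Set

namespace Summit.Ventures.FusionMHD.Bench.SAlphaS25W15

/-- THE GLUED SEGMENT at `α = 3/2` in summed form. [cite: MahboubiMelquiondSibutpinote2016, Sect. 3.3] -/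
theorem c15_seg_all :
    FSegOK (splineDensity (5/2) (3/2) (-32) 1 1 pieces) [1] (2 ^ 60) (panelLeft 1 0) (panelLeft 1 32) (-15327937395949568) (-15327928734711808) := by
  have h := c15_seg
  norm_num at h
  exact h

/-- THE `[-32, 32]` TRIAL FUNCTION IS A WITNESS AT `(5/2, 3/2)`: `UnstableWitness 5/2 (3/2) (-32) 32 X X′`, `2⁶⁰·W ≤ -15327928734711808` (`W ≈ -0.0133`;
enclosure `[-0.0132949, -0.0132949]`). [cite: Freidberg2014, §12.3 eqs. (12.38)–(12.40)] -/
theorem unstableWitness_15 :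
    UnstableWitness (5/2) (3/2) (-32) 32 (trialX 1 1 pieces (-32)) (trialX' 1 1 pieces (-32)) := by
  have h := unstableWitness_of_spline (s := 5/2) (α := 3/2) (a := -32) (h := 1) (m := 1) (ps := pieces)
    one_pos one_pos pieces_ne_nil pieces_match pieces_deriv_match head_zero last_zero c15_seg_all (by decide)
  rw [pieces_length] at h
  norm_num at h
  exact h

/-- THE GLUED SEGMENT at `α = 25/16` in summed form. [cite: MahboubiMelquiondSibutpinote2016, Sect. 3.3] -/
theorem c15625_seg_all :
    FSegOK (splineDensity (5/2) (25/16) (-32) 1 1 pieces) [1] (2 ^ 60) (panelLeft 1 0) (panelLeft 1 32) (-210192168143290368) (-210192158745952256) := by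
  have h := c15625_seg
  norm_num at h
  exact h

/-- THE `[-32, 32]` TRIAL FUNCTION IS A WITNESS AT `(5/2, 25/16)`: `UnstableWitness 5/2 (25/16) (-32) 32 X X′`, `2⁶⁰·W ≤ -210192158745952256` (`W ≈ -0.1823`;
enclosure `[-0.1823126, -0.1823126]`). [cite: Freidberg2014, §12.3 eqs. (12.38)–(12.40)] -/
theorem unstableWitness_15625 :
    UnstableWitness (5/2) (25/16) (-32) 32 (trialX 1 1 pieces (-32)) (trialX' 1 1 pieces (-32)) := by
  have h := unstableWitness_of_spline (s := 5/2) (α := 25/16) (a := -32) (h := 1) (m := 1) (ps := pieces)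
    one_pos one_pos pieces_ne_nil pieces_match pieces_deriv_match head_zero last_zero c15625_seg_all (by decide)
  rw [pieces_length] at h
  norm_num at h
  exact h

/-- ★★ THE BAND: the `[-32, 32]` trial function is a witness at EVERY `α ∈ [3/2, 25/16]` (the energy of a fixed trial function is a convex
quadratic polynomial in `α`): `U_{5/2} ⊇ [3/2, 25/16]`. [cite: Freidberg2014, §12.3 eqs. (12.38)–(12.40)] («… The plasma is unstable», for the band of the MODEL) -/
theorem unstableWitness_band :
    ∀ α ∈ Icc (3/2 : ℝ) (25/16), UnstableWitness (5/2) α (-32) 32 (trialX 1 1 pieces (-32)) (trialX' 1 1 pieces (-32)) :=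
  unstableWitness_of_mem_Icc unstableWitness_15 unstableWitness_15625

/-- … hence every point of the band carries SOME witness, [cite: Freidberg2014, §12.3 eqs. (12.38)–(12.40)] -/
theorem exists_unstableWitness_of_mem_band {α : ℝ} (hα : α ∈ Icc (3/2 : ℝ) (25/16)) :
    ∃ a b : ℝ, ∃ X X' : ℝ → ℝ, UnstableWitness (5/2) α a b X X' :=
  ⟨_, _, _, _, unstableWitness_band α hα⟩

/-- … and none is on the stable side. [cite: Freidberg2014, §12.3 eq. (12.40)] -/
theorem not_stableSide_of_mem_band {α : ℝ} (hα : α ∈ Icc (3/2 : ℝ) (25/16)) : ¬ StableSide (5/2) α := by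
  obtain ⟨a, b, X, X', hw⟩ := exists_unstableWitness_of_mem_band hα
  exact fun hs => hs a b X X' hw

/-- ★★★ THE THIRD-ROUND HALF-GAP END MOVE AT `s = 5/2` IN ONE STATEMENT: the lower end `23/16` is on the STABLE side (gridfusion-model-7 (g9)'s
`SAlphaStableS25A14375M7.stableSide_fiveHalves_2316`, BY NAME) and `3/2` is NOT (this file's witness) — the first-stability edge of the MODEL at `s = 5/2` lies in the
closed interval `[23/16, 3/2]` of width `1/16`. [cite: Freidberg2014, §12.3 eqs. (12.38)–(12.40)] -/
theorem endMove_fiveHalves :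
    StableSide (5/2) (23/16) ∧ ¬ StableSide (5/2) (3/2) :=
  ⟨Summit.Ventures.FusionMHD.Models.SAlphaStableS25A14375M7.stableSide_fiveHalves_2316,
   not_stableSide_of_mem_band ⟨le_rfl, by norm_num⟩⟩

end Summit.Ventures.FusionMHD.Bench.SAlphaS25W15
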